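import Mathlib
import HarnessLib
import Summits.CriticalPhenomena.Ising3DConformalLimit.Theses.LeeYangGap

/-!
# Strategy census s5 — typed companions (planner-cstrat-stmt-CriticalPhenomena-4945-s5)

Typed forms of the statements discussed in `STRATEGY-CENSUS-s5.md` for crux
`LeeYangGap.NearCriticalLeeYangGap` (stmt-CriticalPhenomena-4945).  Nothing here is an item;
these are the signatures the census refers to ("as a signature").  No proofs are claimed except
the elementary bookkeeping lemma at the end.
-/

noncomputable section

namespace Summit.CriticalPhenomena.Ising3DConformalLimit.Cruxes.NearCriticalLeeYangGap.CensusS5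

open Filter Topology
open Literature.Probability.LatticeModels

/-- Block variance `Σ_L = ⟨M_L²⟩⁺_{β_c}` of the critical block spin `M_L = ∑_{x ∈ Λ_L} σ_x` on `ℤ³`. -/
def blockVar (L : ℕ) : ℝ :=
  plusExpect 3 (criticalBeta 3) 0 (fun σ => (∑ x ∈ box 3 L, spinAt x σ) ^ 2)

/-- Fourth moment `⟨M_L⁴⟩⁺_{β_c}`. -/
def blockM4 (L : ℕ) : ℝ :=
  plusExpect 3 (criticalBeta 3) 0 (fun σ => (∑ x ∈ box 3 L, spinAt x σ) ^ 4)

/-- Block Binder ratio `g_L = (3Σ_L² − ⟨M_L⁴⟩)/Σ_L² = −U₄(M_L)/Σ_L²`. -/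
def binder (L : ℕ) : ℝ := (3 * blockVar L ^ 2 - blockM4 L) / blockVar L ^ 2

/-- (Structure) the Binder reading of the crux, both directions landed in the tree
(`PerfectScreeningCoulombImpliesNontrivial.stub_gapOfBinderNonvanishing`,
`PerfectScreeningCoulombImpliesNontrivial.sketchPub_binderNonvanishing_of_nearCriticalLeeYangGap`):
GAP ⟺ `¬ Tendsto binder atTop (𝓝 0)`. -/
def BinderNonvanishing : Prop := ¬ Tendsto binder atTop (𝓝 0)

/-- STRENGTHEN S⁺₁ (eventual form): the Binder ratio is eventually bounded below.  Implies GAP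
trivially; the added rigidity (all large `L` instead of infinitely many) buys nothing: no induction on `L`
is available because `−U₄(M_{2L}) ≥ 8·(−U₄(M_L))` (Lebowitz super-additivity) loses a factor
`2^{7−2η}` per doubling against `Σ_{2L}² ≈ 2^{10−2η} Σ_L²`. -/
def EventualBinderFloor : Prop := ∃ ε : ℝ, 0 < ε ∧ ∀ᶠ L : ℕ in atTop, ε ≤ binder L

/-- STRENGTHEN S⁺₂ (moment-generating-function deficit, the Lee–Yang product form of GAP made
quantitative at one fixed `τ`): `⟨exp(τ M_L/√Σ_L)⟩ ≤ exp((1/2 − ε) τ²)` frequently.  Equivalent to GAP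
up to constants (finite Lee–Yang product `∏ (1 + τ²/t_j²)` with `∑ 2/t_j² = 1`); the truth is far
stronger (`log ⟨exp(τ M_L/√Σ_L)⟩ = O(τ^{2d/(d+2−η)})`), cf. the `d = 2` theorem
Camia–Garban–Newman, AIHP 2016, Prop. 2.2 (`log E e^{tm} ∼ b t^{16/15}`, via FK + RSW). -/
def MGFDeficitFrequently : Prop :=
  ∃ τ : ℝ, 0 < τ ∧ ∃ ε : ℝ, 0 < ε ∧ ∃ᶠ L : ℕ in atTop,
    plusExpect 3 (criticalBeta 3) 0
        (fun σ => Real.exp (τ * (∑ x ∈ box 3 L, spinAt x σ) / Real.sqrt (blockVar L)))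
      ≤ Real.exp ((1 / 2 - ε) * τ ^ 2)

/-- DECOMPOSITION piece P1 (`BoxTwoPointGrowth`, "η ≤ 1/2 box-averaged, with amplitude"):
`Σ_L ≥ c · L^{9/2}` for infinitely many `L`.  Strictly two-point; by Hölder it gives the first-moment
floor `E N_L ≥ Σ_L²/(2L+1)⁹ ≥ c²` for the expected number of intersection points of two independent
sourced double-current clusters at the block scale.  Nearest theorem: Duminil-Copin–Panis 2025
(CMP 406; arXiv:2404.05700) Thm 1.3/1.8 — bubble `B_n(β_c) ≥ c √(log n)`, `B(β_c) = ∞` in `d = 3`,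
i.e. exactly the `η = 1/2` borderline, not the power gain needed here. -/
def BoxTwoPointGrowth : Prop :=
  ∃ c : ℝ, 0 < c ∧ ∃ᶠ L : ℕ in atTop, c * (L : ℝ) ^ (9 / 2 : ℝ) ≤ blockVar L

/-- DECOMPOSITION piece P1' (pointwise form, stronger than P1): a two-point LOWER bound
`⟨σ₀σ_x⟩_{β_c} ≥ c‖x‖^{−3/2}` (η ≤ 1/2 pointwise with amplitude). -/
def TwoPointEtaHalfFloor : Prop :=
  ∃ c : ℝ, 0 < c ∧ ∀ x : Site 3, x ≠ 0 → c * ‖x‖ ^ (-(3 / 2 : ℝ)) ≤ criticalTwoPoint 3 x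

/-- Bookkeeping: the eventual floor trivially gives the Binder reading of GAP (so S⁺₁ ⟹ GAP by the
landed `stub_gapOfBinderNonvanishing`). -/
theorem binderNonvanishing_of_eventualFloor (h : EventualBinderFloor) : BinderNonvanishing := by
  rintro hlim
  obtain ⟨ε, hε, hev⟩ := h
  have hlt : ∀ᶠ L : ℕ in atTop, binder L < ε :=
    (hlim.eventually (Iio_mem_nhds hε))
  obtain ⟨L, hL1, hL2⟩ := (hev.and hlt).exists
  exact absurd hL2 (not_lt.mpr hL1)

end Summit.CriticalPhenomena.Ising3DConformalLimit.Cruxes.NearCriticalLeeYangGap.CensusS5
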